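import Summits.CriticalPhenomena.PercolationContinuityZ3.Theorems.PercNearOneGluingNoHeavyQuantFarHairyCycleReach
import HarnessLib

/-!
# FAR beyond trees: reachability in a hairy cycle WITH RELAYS ON THE CYCLE (degenerate hairs)

builds on p205010 (kernel theorem, internal audit signed; external expert review pending)

Support file (`--supports stmt-CriticalPhenomena-4575`), seat `prim-cert-1` (gen 18); sequel of `…QuantFarHairyCycleReach`, which characterises
`o ↔ t_k` on a hairy cycle whose relays are all pendant tips off the cycle.  Here a hair may be DEGENERATE: `t_k = c_{b_k}`, i.e. the relay
IS the cycle vertex at position `b_k` (the quant lane's rings "with relays at the cycle vertices and/or on pendant hairs").  The hair edge of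
a degenerate hair is a loop and plays no role; the reached condition becomes
`RTD k := RC (b_k) ∧ (t_k = c_{b_k} ∨ hair_k ∈ ω)`.
Hypotheses: cycle of length `L ≥ 3` injective, `b_k < L`, tips injective, and a tip that lies on the cycle is its own base
(`hoff' : t_k = c_i → i = b_k`).  Results (for configurations carried by the cycle and the proper hair edges):

* `HairyCycle.openWalk_invariantD`, `HairyCycle.reachable_tip_of_RTD`, `HairyCycle.mem_openConn_tip_iffD` — **`o ↔ t_k ⟺ RTD k`**.
No measure theory; no sorries; standard axioms.  [cite: KozmaNitzan2024, Conjecture 3 (p. 15)] (context); elementary graph theory otherwise.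
-/

namespace Summit.CriticalPhenomena.PercolationContinuityZ3.Theorems.HairyCycle

open Finset
open Literature.Probability.Percolation

variable {n : ℕ}

/-- Tip `k` is reached, degenerate hairs allowed: its base along an arc, and its hair open unless the tip is the base itself. [this work] -/
def RTD (L : ℕ) (cyc : ℕ → Fin n) (base : ℕ → ℕ) (tip : ℕ → Fin n) (ω : Set (Sym2 (Fin n))) (k : ℕ) : Prop :=
  RC L cyc ω (base k) ∧ (tip k = cyc (base k) ∨ hairE cyc base tip k ∈ ω)

section StructureD

variable (L : ℕ) (cyc : ℕ → Fin n) (K : ℕ) (base : ℕ → ℕ) (tip : ℕ → Fin n)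
  (hL : 3 ≤ L) (hcyc : ∀ i j, i < L → j < L → cyc i = cyc j → i = j)
  (hbase : ∀ k, k < K → base k < L) (htip : ∀ k k', k < K → k' < K → tip k = tip k' → k = k')
  (hoff' : ∀ k i, k < K → i < L → tip k = cyc i → i = base k)
include hL hcyc hbase htip hoff'

/-- **Walk invariant (degenerate hairs allowed).**  Along an open walk of a carried configuration, the property "the vertex is a cycle
vertex `c_i` with `RC i`, or a tip `t_k` with `RTD k`" propagates from the start to the end. [this work] -/
theorem openWalk_invariantD (ω : Set (Sym2 (Fin n))) (hω : Carried L cyc K base tip ω) :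
    ∀ (u v : Fin n) (p : (openGraph ω).Walk u v),
      ((∃ i, i < L ∧ u = cyc i ∧ RC L cyc ω i) ∨ (∃ k, k < K ∧ u = tip k ∧ RTD L cyc base tip ω k)) →
      ((∃ i, i < L ∧ v = cyc i ∧ RC L cyc ω i) ∨ (∃ k, k < K ∧ v = tip k ∧ RTD L cyc base tip ω k)) := by
  intro u v p
  induction p with
  | nil => exact id
  | cons hadj p' ih =>
    rename_i u' x v'
    intro hu
    apply ih
    rw [openGraph_adj] at hadj
    obtain ⟨hmem, hux⟩ := hadj
    have hL0 : 0 < L := by omega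
    -- whatever clause `u'` satisfies, if `u' = c_a` then `RC a`
    have hRCu : ∀ a, a < L → u' = cyc a → RC L cyc ω a := by
      intro a ha hua
      rcases hu with ⟨i', hi', hu', hRC⟩ | ⟨k', hk', hu', hRT⟩
      · rw [hcyc _ _ hi' ha (hu'.symm.trans hua)] at hRC; exact hRC
      · -- a tip sitting on the cycle is its own base
        have hb : a = base k' := hoff' k' a hk' ha (hu'.symm.trans hua)
        rw [hb]; exact hRT.1
    rcases hω u' x hux hmem with ⟨i, hi, he⟩ | ⟨k, hk, he⟩
    · -- a cycle edge `e_i`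
      have hi1 : (i + 1) % L < L := Nat.mod_lt _ hL0
      have hends : (u' = cyc i ∧ x = cyc ((i + 1) % L)) ∨ (u' = cyc ((i + 1) % L) ∧ x = cyc i) := by
        unfold cycE at he
        rcases Sym2.eq_iff.1 he with ⟨h1, h2⟩ | ⟨h1, h2⟩
        · exact Or.inl ⟨h1, h2⟩
        · exact Or.inr ⟨h1, h2⟩
      left
      rcases hends with ⟨hu1, hx1⟩ | ⟨hu1, hx1⟩
      · refine ⟨(i + 1) % L, hi1, hx1, ?_⟩
        have hRCi := hRCu i hi hu1
        by_cases hlt : i + 1 < L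
        · rw [Nat.mod_eq_of_lt hlt]; exact RC_succ L cyc hRCi (he ▸ hmem)
        · have : i + 1 = L := by omega
          rw [this, Nat.mod_self]; exact RC_zero L cyc ω
      · refine ⟨i, hi, hx1, ?_⟩
        by_cases hlt : i + 1 < L
        · have hRCi1 := hRCu (i + 1) hlt (by rw [hu1, Nat.mod_eq_of_lt hlt])
          exact RC_pred L cyc hRCi1 (he ▸ hmem)
        · have hiL : i = L - 1 := by omega
          subst hiL
          exact RC_last L cyc hL (he ▸ hmem)
    · -- a proper hair edge (it is open and not a loop, so the hair is not degenerate)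
      have hbk := hbase k hk
      unfold hairE at he
      rcases Sym2.eq_iff.1 he with ⟨hu1, hx1⟩ | ⟨hu1, hx1⟩
      · -- step `base → tip`
        right
        refine ⟨k, hk, hx1, hRCu (base k) hbk hu1, Or.inr ?_⟩
        unfold hairE; exact he ▸ hmem
      · -- step `tip → base`
        left
        refine ⟨base k, hbk, hx1, ?_⟩
        rcases hu with ⟨i', hi', hu', hRC⟩ | ⟨k', hk', hu', hRT⟩
        · -- `u' = t_k = c_{i'}`: then `i' = b_k`
          have := hoff' k i' hk hi' (hu1.symm.trans hu')
          rw [← this]; exact hRC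
        · rw [htip _ _ hk' hk (hu'.symm.trans hu1)] at hRT; exact hRT.1

omit htip hoff' in
/-- `RTD k` connects `c_0` to the tip `t_k`. [this work] -/
theorem reachable_tip_of_RTD (ω : Set (Sym2 (Fin n))) {k : ℕ} (hk : k < K) (h : RTD L cyc base tip ω k) :
    (openGraph ω).Reachable (cyc 0) (tip k) := by
  have h1 := reachable_cyc_of_RC L cyc hL hcyc ω (hbase k hk) h.1
  rcases h.2 with hdeg | hhair
  · rw [hdeg]; exact h1
  · by_cases hdeg : tip k = cyc (base k)
    · rw [hdeg]; exact h1
    · have hadj : (openGraph ω).Adj (cyc (base k)) (tip k) := by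
        rw [openGraph_adj]
        exact ⟨hhair, fun heq => hdeg heq.symm⟩
      exact h1.trans hadj.reachable

/-- **Reachability of a tip, degenerate hairs allowed: `o ↔ t_k ⟺ RTD k`** for carried configurations. [this work] -/
theorem mem_openConn_tip_iffD (ω : Set (Sym2 (Fin n))) (hω : Carried L cyc K base tip ω) {k : ℕ} (hk : k < K) :
    ω ∈ openConn (cyc 0) (tip k) ↔ RTD L cyc base tip ω k := by
  constructor
  · intro h
    obtain ⟨p⟩ := (h : (openGraph ω).Reachable (cyc 0) (tip k))
    rcases openWalk_invariantD L cyc K base tip hL hcyc hbase htip hoff' ω hω _ _ p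
        (Or.inl ⟨0, by omega, rfl, RC_zero L cyc ω⟩) with ⟨i, hi, hti, hRC⟩ | ⟨k', hk', htk, hRT⟩
    · -- the tip sits on the cycle: degenerate hair
      have hb := hoff' k i hk hi hti
      subst hb
      exact ⟨hRC, Or.inl hti⟩
    · rw [htip _ _ hk hk' htk]; exact hRT
  · exact fun h => reachable_tip_of_RTD L cyc K base tip hL hcyc hbase ω hk h

end StructureD

end Summit.CriticalPhenomena.PercolationContinuityZ3.Theorems.HairyCycle
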